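import Literature.Barriers.PneNP.LowDegreeCounterexamplesCodes64FF
import Literature.NumberTheory.DiophantineGeometry.GarciaStichtenothGenus
import Literature.NumberTheory.DiophantineGeometry.GarciaStichtenothSplit
import HarnessLib

/-!
# Barrier catalogue `PneNP`: the Garcia–Stichtenoth one-point data over `𝔽₆₄` exist
(`GarciaStichtenothOnePoint64_holds`)

`Literature/Barriers/PneNP/LowDegreeCounterexamplesCodes64GS.lean` states the named fact
`GarciaStichtenothOnePoint64` (for every `i`, one-point data over `𝔽₆₄` with `7·8^{i+2}` evaluation
places and at most `8^{i+2}` gaps), the input of Guruswami's `𝔽₆₄`-codes [Shpilka 2009, App. A,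
Thm. 24 at `r = 8`] below Holmgren–Wein's Prop. 3.
`Literature/Barriers/PneNP/LowDegreeCounterexamplesCodes64FF.lean` reduces it
(`GarciaStichtenothOnePoint64.of_card_ratPlaces`) to the printed input of [Shpilka 2009, App. A,
p. 25]: for each `i`, an algebraic function field `F/𝔽₆₄` of genus `≤ 8^{i+2}` with at least
`7·8^{i+2} + 1` rational places.

This file discharges the fact: the level `G_{i+1}` of the (second) Garcia–Stichtenoth tower over
`𝔽₆₄ = 𝔽_{q²}`, `q = 8` (`Literature/NumberTheory/DiophantineGeometry/GarciaStichtenothTower.lean`,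
[Stichtenoth 2009, Def. 7.4.1]) has genus `≤ q^{i+2} - q` (`GSTower.genus_level_le`,
[Stichtenoth 2009, Thm. 7.4.7 with Remark 7.4.10]; here through the differential `dx₀`) and at
least `(q² - q)q^{i+1} + 1 = 7·8^{i+2} + 1` rational places (`GSTower.exists_ratPlaces_level`,
[Stichtenoth 2009, Lemma 7.4.3–7.4.4]). The only field-specific input is that the elements `c` of
an extension of `𝔽₆₄` with `c^8 = c` lie in `𝔽₆₄` (`GarciaStichtenothOnePoint64.pow_eight_fixed`).

## References

* A. Shpilka, *Constructions of low-degree and error-correcting ε-biased generators*, comput.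
  complexity 18 (2009), App. A (V. Guruswami), Thm. 24 and its proof, p. 25. Held.
* H. Stichtenoth, *Algebraic Function Fields and Codes*, 2nd ed., GTM 254, Springer 2009, §7.4
  (Def. 7.4.1, Lemma 7.4.3–7.4.4, Thm. 7.4.7, Remark 7.4.10). Held.
* [GS96] A. Garcia, H. Stichtenoth, *On the asymptotic behaviour of some towers of function fields
  over finite fields*, J. Number Theory 61 (1996) 248–273, §3.
-/

noncomputable section

namespace Literature.Barriers.PneNP

open scoped Polynomial
open Polynomial
open Literature.NumberTheory.DiophantineGeometry
open Literature.NumberTheory.DiophantineGeometry.AlgFunctionField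
open Literature.NumberTheory.DiophantineGeometry.GSTower

/-- In any field extension `L'` of `𝔽₆₄`, an element with `c^8 = c` comes from `𝔽₆₄` (indeed
`c^64 = c`, and the `64` images of `𝔽₆₄` exhaust the roots of `X^64 - X`). [folklore] -/
theorem GarciaStichtenothOnePoint64.pow_eight_fixed (L' : Type) [Field L'] [Algebra F64 L']
    (c : L') (hc : c ^ 8 = c) : ∃ γ : F64, algebraMap F64 L' γ = c := by
  classical
  letI : Fintype F64 := Fintype.ofFinite F64
  have hcard : Fintype.card F64 = 64 := by
    rw [← Nat.card_eq_fintype_card]; exact GaloisField.card 2 6 (by norm_num)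
  have hc64 : c ^ 64 = c := by
    rw [show (64 : ℕ) = 8 * 8 from rfl, pow_mul, hc, hc]
  set f : L'[X] := X ^ 64 - X with hf
  have hf0 : f ≠ 0 := FiniteField.X_pow_card_sub_X_ne_zero L' (by norm_num)
  have hfdeg : f.natDegree = 64 := FiniteField.X_pow_card_sub_X_natDegree_eq L' (by norm_num)
  set S : Finset L' := Finset.univ.image (algebraMap F64 L') with hS
  have hScard : S.card = 64 := by
    rw [hS, Finset.card_image_of_injective _ (algebraMap F64 L').injective, Finset.card_univ, hcard]
  have hsub : S ⊆ f.roots.toFinset := by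
    intro a ha
    obtain ⟨γ, -, rfl⟩ := Finset.mem_image.1 ha
    rw [Multiset.mem_toFinset, mem_roots hf0, IsRoot.def, hf, eval_sub, eval_pow, eval_X,
      ← map_pow, ← hcard, FiniteField.pow_card, sub_self]
  have hle : f.roots.toFinset.card ≤ S.card :=
    (Multiset.toFinset_card_le _).trans ((card_roots' f).trans (by rw [hfdeg, hScard]))
  have heq : S = f.roots.toFinset := Finset.eq_of_subset_of_card_le hsub hle
  have hcS : c ∈ S := by
    rw [heq, Multiset.mem_toFinset, mem_roots hf0, IsRoot.def, hf, eval_sub, eval_pow, eval_X,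
      hc64, sub_self]
  obtain ⟨γ, -, hγ⟩ := Finset.mem_image.1 hcS
  exact ⟨γ, hγ⟩

/-- **The Garcia–Stichtenoth one-point data over `𝔽₆₄` exist** (`GarciaStichtenothOnePoint64`):
for every `i`, the level `G_{i+1}` of the Garcia–Stichtenoth tower over `𝔽₆₄` has genus
`≤ 8^{i+2} - 8 ≤ 8^{i+2}` and at least `56·8^{i+1} + 1 = 7·8^{i+2} + 1` rational places, which is
the input of `GarciaStichtenothOnePoint64.of_card_ratPlaces`.
[cite: Shpilka2009, App. A, Thm. 24 and its proof (p. 25)]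
[cite: Stichtenoth2009, Thm. 7.4.7, Remark 7.4.10, Lemma 7.4.3–7.4.4] -/
theorem GarciaStichtenothOnePoint64_holds : GarciaStichtenothOnePoint64 := by
  classical
  refine GarciaStichtenothOnePoint64.of_card_ratPlaces fun i => ?_
  letI : Fintype F64 := Fintype.ofFinite F64
  haveI : Fact (2 ≤ 8) := ⟨by norm_num⟩
  have hK : Fintype.card F64 = 8 ^ 2 := by
    rw [← Nat.card_eq_fintype_card]; exact GaloisField.card 2 6 (by norm_num)
  have hqp : (8 : ℕ) = 2 ^ 3 := by norm_num
  have hg := genus_level_le (K := F64) (q := 8) hqp GarciaStichtenothOnePoint64.pow_eight_fixed (i + 1)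
  obtain ⟨T, hT, hTcard⟩ := exists_ratPlaces_level (K := F64) (q := 8) hK hqp (i + 1)
  refine ⟨(level F64 8 (i + 1)).carrier, inferInstance, inferInstance, inferInstance, ?_, T, hT, ?_⟩
  · have hg' : ((genus F64 (level F64 8 (i + 1)).carrier : ℕ) : ℤ) ≤ ((8 ^ (i + 2) : ℕ) : ℤ) := by
      push_cast at hg ⊢
      have h8 : (8 : ℤ) ^ (i + 1 + 1) = 8 ^ (i + 2) := by ring
      linarith
    exact_mod_cast hg'
  · have h7 : agLength i = 7 * 8 ^ (i + 2) := rfl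
    rw [h7]
    calc 7 * 8 ^ (i + 2) + 1 = (8 ^ 2 - 8) * 8 ^ (i + 1) + 1 := by ring
      _ ≤ T.card := hTcard

end Literature.Barriers.PneNP
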